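import Summits.ResolutionOfSingularities.ResolutionOfSingularities.Theorems.LossExitCone3
import Summits.ResolutionOfSingularities.ResolutionOfSingularities.Theorems.LossExitCone4
import HarnessLib

/-!
# LossPencil — the LOSS-(a) PENCIL LAW: a translated move in the RUN chart from a run state has tangent cone the
`s`-fold plane `u_l = (β_l/β_j)·u_j` (kernel, hypothesis-free, every `q = pᵉ`, every field)

decomp-res-lens-3, gen 28 (TOOLS, score 0, banked by name; completes the six-arrow dictionary of the loss episode begun by
`LossExitCone.exit_initialForm` (X1 / loss-(b), chart `j`) and `LossExitCone.switch_law` (X2 / loss-(c), chart `l`)).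

At a run state `(i,j,l;k,m)` — `r_u = k·e_i + m·e_j`, `u_j^m`-layer of `F_u` = `c·u_i^k u_j^m u_l^s·V`, plateau of shade
`s`, `q < s+k+m` — a move in the RUN chart `i` that is translated off the loss wall (`β_j := W.b u j ≠ 0`; it is then a
TOTAL LOSS, the loss of type (a)) satisfies

* `lossA_law`: `resForm W u (s+k+m) = C (c·V(0)) · (u_l − λ·u_j)^s` with `λ = β_l/β_j` (`β_l := W.b u l`);
* `lossA_resLayer`: the dehomogenised residual layer itself is the same pure power (the line passes through the centre);
* `lossA_initialForm`: for every `|E| = s`, `coeff_{r_u+E} F_u = c·V(0) · coeff_E (u_l − λ·u_j)^s` — the initial form of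
  `F_u` is `u^{r_u} · c V(0) · (u_l − λ u_j)^s`: the residual tangent cone is the `s`-FOLD PLANE `u_l = λ u_j` containing the
  run axis `u_i` and the centre `(1 : β_j : β_l)` of the move.

Together with the landed laws (`exit_initialForm` has no hypothesis on `W.b u i`, `switch_law` none on `W.b u i`), EVERY
non-R arrow leaving a run state forces `e = 2`: `in(F_u)/u^{r_u} = φ₀·(u_l − λu_j)^s`, and its centre lies on the line
`{u_l = λu_j} ⊂ ℙ(E)`: X1/X2 at `(0:1:λ)`, the losses (a)/(b)/(c) at `(1:β:λβ)`, `β ≠ 0` (parameter dictionary: X1 `γ = λ`,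
X2 `β_j = 1/λ`, loss-(a) `β_l/β_j = λ`, loss-(b) `γ₁ = λ`, loss-(c) `γ₂ = 1/λ`).  Mechanism = that of `switch_law`: the cone
law `ConeCut.cone_of_plateau` makes `Φ = resForm` a non-zero binary form of degree `s` in `u_j, u_l`; the layer hypothesis
pins the `u_j`-free part of the dehomogenised residual layer `R = Φ(u − β)` to `c V(0)·u_l^s`; the candidate
`Ψ₀ = cV(0)(u_l − λu_j)^s` is its own translate (`β_l = λβ_j`) and has the same `u_j`-free part, so `Φ − Ψ₀` is killed by
the rigidity lemma `LossExitCone.eq_zero_of_translate_free`.  No `sorry`, standard axioms.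
-/

open MvPolynomial Finset
open Literature.AlgebraicGeometry.Resolution
open Literature.AlgebraicGeometry.Resolution.Hauser2010
open Literature.AlgebraicGeometry.Resolution.PointBlowup
open Literature.AlgebraicGeometry.Resolution.WeightedBlowup
open Summit.ResolutionOfSingularities.ResolutionOfSingularities.Theorems.TightDefectClasses
open Summit.ResolutionOfSingularities.ResolutionOfSingularities.Theorems.TightDefectStrongWalks
open Summit.ResolutionOfSingularities.ResolutionOfSingularities.Theorems.ItineraryCutClasses
open Summit.ResolutionOfSingularities.ResolutionOfSingularities.Theorems.BoundaryLedger
open Summit.ResolutionOfSingularities.ResolutionOfSingularities.Theorems.ProximityCut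
open Summit.ResolutionOfSingularities.ResolutionOfSingularities.Theorems.ConeCut
open Summit.ResolutionOfSingularities.ResolutionOfSingularities.Theorems.WallCutRun
open Summit.ResolutionOfSingularities.ResolutionOfSingularities.Theorems.LossExitCone

namespace Summit.ResolutionOfSingularities.ResolutionOfSingularities.Theorems.LossPencil

variable {K : Type} [Field K] [DecidableEq K] {q : ℕ} {s₀ : State (Fin 3) K}

/-! ## §1 Algebra of the linear form `u_l − λ u_j` -/

section Algebra

omit [DecidableEq K] in
/-- A line through the centre is its own translate: if `b l = λ · b j` then `(u_l − λu_j)(u + b) = u_l − λu_j`. [folklore] -/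
theorem translate_linear_self (b : Fin 3 → K) (l j : Fin 3) (lam : K) (h : b l = lam * b j) :
    PointBlowup.translate b (X l - C lam * X j) = X l - C lam * X j := by
  rw [translate_linear, h, map_mul]
  ring

omit [DecidableEq K] in
/-- `(u_l − λ u_j)^n` is a form of degree `n`. [folklore] -/
theorem isHomogeneous_linear_pow (l j : Fin 3) (lam : K) (n : ℕ) :
    ((X l - C lam * X j : MvPolynomial (Fin 3) K) ^ n).IsHomogeneous n := by
  have h1 : (X l - C lam * X j : MvPolynomial (Fin 3) K).IsHomogeneous 1 := by
    have h := (isHomogeneous_C (Fin 3) lam).mul (isHomogeneous_X K j)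
    rw [zero_add] at h
    exact (isHomogeneous_X K l).sub h
  have h := h1.pow n
  rwa [one_mul] at h

omit [DecidableEq K] in
/-- The pure `u_l`-powers in `(u_l − λ u_j)^n`: only `u_l^n`, with coefficient `1` (`l ≠ j`). [folklore] -/
theorem coeff_single_linear_pow {l j : Fin 3} (hlj : l ≠ j) (lam : K) (n c : ℕ) :
    coeff (Finsupp.single l c) ((X l - C lam * X j : MvPolynomial (Fin 3) K) ^ n) = if c = n then 1 else 0 := by
  classical
  rw [sub_eq_add_neg, ← neg_mul, ← C_neg, linear_pow_eq_sum (-lam) n, coeff_sum]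
  by_cases hc : c = n
  · rw [if_pos hc, Finset.sum_eq_single n]
    · rw [coeff_monomial, if_pos, Nat.choose_self, Nat.cast_one, Nat.sub_self, pow_zero, mul_one]
      unfold binExp
      rw [hc, Nat.sub_self, Finsupp.single_zero, zero_add]
    · intro a ha han
      rw [coeff_monomial, if_neg]
      intro h
      apply han
      have h' := DFunLike.congr_fun h l
      rw [binExp_apply_k hlj, Finsupp.single_eq_same] at h'
      omega
    · intro h
      exact absurd (Finset.mem_range.mpr (Nat.lt_succ_self n)) h
  · rw [if_neg hc]
    refine Finset.sum_eq_zero (fun a ha => ?_)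
    rw [Finset.mem_range] at ha
    rw [coeff_monomial, if_neg]
    intro h
    have hl := DFunLike.congr_fun h l
    have hj := DFunLike.congr_fun h j
    rw [binExp_apply_k hlj, Finsupp.single_eq_same] at hl
    unfold binExp at hj
    rw [Finsupp.add_apply, Finsupp.single_eq_same, Finsupp.single_eq_of_ne hlj.symm, add_zero,
      Finsupp.single_eq_of_ne hlj.symm] at hj
    omega

end Algebra

/-! ## §2 The loss-(a) law -/

section LossA

/-- **LOSS-(a) PENCIL LAW (PROVED).**  At a run state (chart letter `i = W.j u` = the run wall, loss wall `j` of mass `m`,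
free letter `l`; `r_u = k·e_i + m·e_j`; `u_j^m`-layer `c·u_i^k u_j^m u_l^s·V`; plateau of shade `s`; `q < s+k+m`), a move in
the run chart TRANSLATED OFF THE LOSS WALL (`W.b u j ≠ 0`) has residual form the pure power
`C (c·V(0)) · (u_l − λ·u_j)^s`, `λ = (W.b u l)/(W.b u j)`. [new] [folklore] -/
theorem lossA_law (hroot : IsRoot q s₀) (W : ForcedWalk q s₀) (u : ℕ) {j l : Fin 3} {k m s : ℕ} {c : K}
    {V : MvPolynomial (Fin 3) K} (hji : j ≠ W.j u) (hli : l ≠ W.j u) (hlj : l ≠ j)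
    (hr : (W.st u).r = Finsupp.single (W.j u) k + Finsupp.single j m)
    (hsh : (W.st u).shade = (s : ℕ∞)) (hplat : (W.st (u + 1)).shade = (W.st u).shade) (hq : q < s + k + m)
    (hlayer : ∀ D : Fin 3 →₀ ℕ, D j = m → coeff D (W.st u).F =
      coeff D (monomial (Finsupp.single (W.j u) k + Finsupp.single j m + Finsupp.single l s) c * V))
    (hbj : W.b u j ≠ 0) :
    ordZero (W.st u).F = ((s + k + m : ℕ) : ℕ∞) ∧
      resForm W u (s + k + m) = C (c * coeff 0 V) * (X l - C (W.b u l / W.b u j) * X j) ^ s := by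
  classical
  obtain ⟨o, ho, -⟩ := walk_nat hroot W u
  obtain ⟨n, hn, hon⟩ := order_eq_shade_add_degree hroot W u ho
  have hns : n = s := by
    have h := hsh
    rw [hn] at h
    exact_mod_cast h
  subst hns
  have hrdeg : (W.st u).r.degree = k + m := by
    rw [hr, map_add, Finsupp.degree_single, Finsupp.degree_single]
  have hos : o = n + k + m := by rw [hrdeg] at hon; omega
  subst hos
  refine ⟨ho, ?_⟩
  set lam : K := W.b u l / W.b u j with hlam
  have hcone := cone_of_plateau hroot W u ho hq hplat hn
  have hij : W.j u ≠ j := fun h => hji h.symm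
  have hil : W.j u ≠ l := fun h => hli h.symm
  -- the `u_j`-free coefficients of the dehomogenised residual layer `R` (dehomogenised at the chart letter `i`)
  have hRfree : ∀ c' : ℕ, coeff (Finsupp.single l c') (resLayer (W.j u) (W.st u) (n + k + m)) =
      if c' = n then c * coeff 0 V else 0 := by
    intro c'
    by_cases hc : c' ≤ n
    · have hm' : (Finsupp.single (W.j u) (n - c') + Finsupp.single l c').degree + (W.st u).r.degree = n + k + m := by
        rw [map_add, Finsupp.degree_single, Finsupp.degree_single, hrdeg]
        omega
      have hupd : (Finsupp.single (W.j u) (n - c') + Finsupp.single l c').update (W.j u) 0 = Finsupp.single l c' := by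
        ext w
        rw [update_apply', Finsupp.add_apply]
        by_cases hw : w = W.j u
        · rw [if_pos hw, hw, Finsupp.single_eq_of_ne hil]
        · rw [if_neg hw, Finsupp.single_eq_of_ne hw, zero_add]
      rw [← hupd, coeff_resLayer (W.j u) (W.st u) (walk_r hroot W u) _ _ hm']
      have hDj : ((W.st u).r + (Finsupp.single (W.j u) (n - c') + Finsupp.single l c')) j = m := by
        rw [hr, Finsupp.add_apply, Finsupp.add_apply, Finsupp.add_apply, Finsupp.single_eq_same,
          Finsupp.single_eq_of_ne hij.symm, Finsupp.single_eq_of_ne hij.symm, Finsupp.single_eq_of_ne hlj.symm, zero_add,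
          add_zero, add_zero]
      rw [hlayer _ hDj, coeff_monomial_mul', hr]
      by_cases hcn : c' = n
      · subst hcn
        rw [if_pos rfl, Nat.sub_self, Finsupp.single_zero, zero_add, if_pos le_rfl, tsub_self]
      · rw [if_neg hcn, if_neg]
        intro hle
        apply hcn
        have h := Finsupp.le_def.mp hle l
        simp only [Finsupp.add_apply, Finsupp.single_eq_same, Finsupp.single_eq_of_ne hli,
          Finsupp.single_eq_of_ne hlj] at h
        omega
    · rw [if_neg (by omega)]
      by_contra hne
      have hA := degree_le_of_mem_support_resLayer (W.j u) (W.st u) (walk_r hroot W u) (n + k + m)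
        (mem_support_iff.mpr hne)
      rw [Finsupp.degree_single, hrdeg] at hA
      omega
  have hRΦ : resLayer (W.j u) (W.st u) (n + k + m) = PointBlowup.translate (-W.b u) (resForm W u (n + k + m)) := by
    unfold resForm
    rw [LossExitCone.translate_translate, neg_add_cancel, PointBlowup.translate_zero]
  -- the candidate and its properties
  have hX : (C (c * coeff 0 V) * (X l - C lam * X j) ^ n : MvPolynomial (Fin 3) K).IsHomogeneous n := by
    have h := (isHomogeneous_C (Fin 3) (c * coeff 0 V)).mul (isHomogeneous_linear_pow l j lam n)
    rwa [zero_add] at h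
  have hself : PointBlowup.translate (-W.b u) (C (c * coeff 0 V) * (X l - C lam * X j) ^ n) =
      C (c * coeff 0 V) * (X l - C lam * X j) ^ n := by
    rw [translate_C_mul_pow, translate_linear_self]
    rw [Pi.neg_apply, Pi.neg_apply, hlam, mul_neg, div_mul_cancel₀ _ hbj]
  have hΨ := eq_zero_of_translate_free (-W.b u) hlj hli hji (by rw [Pi.neg_apply, neg_ne_zero]; exact hbj)
    (resForm W u (n + k + m) - C (c * coeff 0 V) * (X l - C lam * X j) ^ n) (hcone.1.sub hX) ?_ ?_
  · exact sub_eq_zero.mp hΨ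
  · intro A hA
    by_contra h
    apply mem_support_iff.mp hA
    rw [coeff_sub, coeff_resForm_eq_zero W u _ h, coeff_C_mul, coeff_linear_pow_eq_zero j l lam (Or.inr ⟨W.j u, hij, hil, h⟩),
      mul_zero, sub_zero]
  · intro c'
    have tsub : PointBlowup.translate (-W.b u) (resForm W u (n + k + m) - C (c * coeff 0 V) * (X l - C lam * X j) ^ n)
        = PointBlowup.translate (-W.b u) (resForm W u (n + k + m)) -
          PointBlowup.translate (-W.b u) (C (c * coeff 0 V) * (X l - C lam * X j) ^ n) := by
      unfold PointBlowup.translate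
      exact map_sub _ _ _
    rw [tsub, coeff_sub, ← hRΦ, hRfree, hself, coeff_C_mul, coeff_single_linear_pow hlj]
    by_cases hcn : c' = n
    · rw [if_pos hcn, if_pos hcn, mul_one, sub_self]
    · rw [if_neg hcn, if_neg hcn, mul_zero, sub_zero]

/-- **LOSS-(a) LAW — dehomogenised initial form (PROVED):** under the hypotheses of `lossA_law` the dehomogenised residual
layer itself is `C (cV(0)) · (u_l − λ u_j)^s` (the line `u_l = λu_j` passes through the centre `(β_j, β_l)`). [new] [folklore] -/
theorem lossA_resLayer (hroot : IsRoot q s₀) (W : ForcedWalk q s₀) (u : ℕ) {j l : Fin 3} {k m s : ℕ} {c : K}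
    {V : MvPolynomial (Fin 3) K} (hji : j ≠ W.j u) (hli : l ≠ W.j u) (hlj : l ≠ j)
    (hr : (W.st u).r = Finsupp.single (W.j u) k + Finsupp.single j m)
    (hsh : (W.st u).shade = (s : ℕ∞)) (hplat : (W.st (u + 1)).shade = (W.st u).shade) (hq : q < s + k + m)
    (hlayer : ∀ D : Fin 3 →₀ ℕ, D j = m → coeff D (W.st u).F =
      coeff D (monomial (Finsupp.single (W.j u) k + Finsupp.single j m + Finsupp.single l s) c * V))
    (hbj : W.b u j ≠ 0) :
    resLayer (W.j u) (W.st u) (s + k + m) = C (c * coeff 0 V) * (X l - C (W.b u l / W.b u j) * X j) ^ s := by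
  have h := (lossA_law hroot W u hji hli hlj hr hsh hplat hq hlayer hbj).2
  have hRΦ : resLayer (W.j u) (W.st u) (s + k + m) = PointBlowup.translate (-W.b u) (resForm W u (s + k + m)) := by
    unfold resForm
    rw [LossExitCone.translate_translate, neg_add_cancel, PointBlowup.translate_zero]
  rw [hRΦ, h, translate_C_mul_pow, translate_linear_self]
  rw [Pi.neg_apply, Pi.neg_apply, mul_neg, div_mul_cancel₀ _ hbj]

/-- **LOSS-(a) LAW — initial form (PROVED):** for every `|E| = s`, `coeff_{r_u + E} F_u = c·V(0) · coeff_E (u_l − λ·u_j)^s`: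
the initial form of `F_u` is `u^{r_u} · cV(0) · (u_l − λ u_j)^s`, `λ = β_l/β_j` — the residual tangent cone is the
`s`-fold PLANE `u_l = λ u_j`, containing the run axis and the centre of the move. [new] [folklore] -/
theorem lossA_initialForm (hroot : IsRoot q s₀) (W : ForcedWalk q s₀) (u : ℕ) {j l : Fin 3} {k m s : ℕ} {c : K}
    {V : MvPolynomial (Fin 3) K} (hji : j ≠ W.j u) (hli : l ≠ W.j u) (hlj : l ≠ j)
    (hr : (W.st u).r = Finsupp.single (W.j u) k + Finsupp.single j m)
    (hsh : (W.st u).shade = (s : ℕ∞)) (hplat : (W.st (u + 1)).shade = (W.st u).shade) (hq : q < s + k + m)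
    (hlayer : ∀ D : Fin 3 →₀ ℕ, D j = m → coeff D (W.st u).F =
      coeff D (monomial (Finsupp.single (W.j u) k + Finsupp.single j m + Finsupp.single l s) c * V))
    (hbj : W.b u j ≠ 0) (E : Fin 3 →₀ ℕ) (hE : E.degree = s) :
    coeff ((W.st u).r + E) (W.st u).F = (c * coeff 0 V) * coeff E ((X l - C (W.b u l / W.b u j) * X j) ^ s) := by
  classical
  have hrdeg : (W.st u).r.degree = k + m := by
    rw [hr, map_add, Finsupp.degree_single, Finsupp.degree_single]
  have hres := lossA_resLayer hroot W u hji hli hlj hr hsh hplat hq hlayer hbj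
  rw [← coeff_resLayer (W.j u) (W.st u) (walk_r hroot W u) (s + k + m) E (by rw [hE, hrdeg, add_assoc]), hres,
    coeff_C_mul]
  congr 1
  by_cases hEi : E (W.j u) = 0
  · rw [update_zero_of_apply_eq_zero hEi]
  · rw [coeff_linear_pow_eq_zero j l _ (Or.inr ⟨W.j u, fun h => hji h.symm, fun h => hli h.symm, hEi⟩),
      coeff_linear_pow_eq_zero j l _ (Or.inl ?_)]
    intro hdeg
    have h := degree_update_zero_add E (W.j u)
    omega

end LossA

end Summit.ResolutionOfSingularities.ResolutionOfSingularities.Theorems.LossPencil
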